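import Literature.AlgebraicTopology.SingularHomology.PairTimesCircle
import Mathlib.Analysis.Convex.Contractible
import HarnessLib

/-!
# Betti numbers of `S¹ × K`: finiteness and the bound `bₖ(S¹ × K) ≤ bₖ(K) + bₖ₋₁(K)`

A. Hatcher, *Algebraic Topology* (2002), §2.1 (exact sequence of the pair, Prop. 2.19, Thm. 2.20)
and §3.B (Künneth formula, Thm. 3B.6 / Cor. 3B.7: `Hₙ(X × S¹) ≅ Hₙ(X) ⊕ Hₙ₋₁(X)` for field
coefficients). For ANY space `K`, `S¹ = ℝ/ℤ = AddCircle 1` and the closed quarter arc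
`D = B̄(0, ¼) ⊂ S¹`, the tree has the relative term of the pair `(S¹ × K, D × K)`:
`Hₙ(S¹ × K, D × K) ≅ Hₙ(I × K, ∂I × K)` (`relativeSingularHomology.nonempty_circlePairIso`,
`PairTimesCircle.lean`) and `Hₖ₊₁((I, ∂I) × K) ≅ Hₖ(K)`, `H₀((I, ∂I) × K) = 0`
(`relativeSingularHomology.nonempty_prodUnitIntervalIso`,
`isZero_relativeSingularHomology_prodUnitInterval_zero`, `PairTimesInterval.lean`), while
`D × K ≅ I × K ≃ K` (`nonempty_quarterArcStripHomeomorph`, contractibility of `I`). This file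
draws the consequences for the individual homology groups (the Euler-characteristic consequence
`χ(S¹ × K) = 0` being `FinRelHomology.addCircle_prod`):

* `nonempty_singularHomology_arcStrip_iso` — `Hₙ(D × K; M) ≅ Hₙ(K; M)`;
* `nonempty_relativeSingularHomology_circleArcStrip_iso` — `Hₙ₊₁(S¹ × K, D × K; M) ≅ Hₙ(K; M)`,
  `isZero_relativeSingularHomology_circleArcStrip_zero` — `H₀(S¹ × K, D × K; M) = 0`;
* from the exactness of `Hₙ(D × K) → Hₙ(S¹ × K) → Hₙ(S¹ × K, D × K)` alone, over a field `F`: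
  **finiteness** `Module.Finite F Hₙ(S¹ × K; F)` as soon as `Hₙ(K; F)` and `Hₙ₋₁(K; F)` are finite
  dimensional (`finite_singularHomology_circleProd_succ`, `…_zero`), and the **rank bound**
  `bₙ₊₁(S¹ × K) ≤ bₙ₊₁(K) + bₙ(K)`, `b₀(S¹ × K) ≤ b₀(K)`
  (`finrank_singularHomology_circleProd_succ_le`, `finrank_singularHomology_circleProd_zero_le`), also with the factors
  swapped (`…_prodCircle_…`).

The reverse inequality — hence the Künneth formula `bₙ₊₁(K × S¹) = bₙ₊₁(K) + bₙ(K)` — is obtained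
in cohomology in the sequel (`CircleProductKunneth.lean`) from the injectivity of
`(a, b) ↦ pr₁*a + pr₁*b ⌣ pr₂*θ` (loop transfer, `LoopTransfer.lean`); only the bound and the
finiteness are needed there, so no splitting of the exact sequence is constructed here.
Everything is proved; no named facts, no new notions besides the abbreviation `circleArcStrip`.

## References

* A. Hatcher, *Algebraic Topology*, CUP 2002, §2.1 p. 118 (exact sequence of the pair),
  Prop. 2.19, Thm. 2.20; §3.B Thm. 3B.6, Cor. 3B.7. [HatcherAT2002]
-/

noncomputable section

open CategoryTheory Limits Set unitInterval Metric

universe u v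

namespace Literature.AlgebraicTopology.SingularHomology

section ArcStrip

variable (R : Type v) [CommRing R] (M : Type v) [AddCommGroup M] [Module R M]
variable {K : Type u} [TopologicalSpace K]

variable (K) in
/-- The quarter-arc strip `D × K ⊂ S¹ × K`, `D = B̄(0, ¼)` the closed arc of `S¹ = ℝ/ℤ` around `0`
(the subspace of the pair `(S¹ × K, D × K)` of `PairTimesCircle.lean`). [cite: HatcherAT2002, §2.1 Thm. 2.20] -/
abbrev circleArcStrip : Set (AddCircle (1 : ℝ) × K) :=
  Prod.fst ⁻¹' closedBall (0 : AddCircle (1 : ℝ)) (1 / 4)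

/-- **`Hₙ(D × K; M) ≅ Hₙ(K; M)`**: the strip is a cylinder `I × K` (`nonempty_quarterArcStripHomeomorph`)
and the cylinder deformation retracts onto `K` (`I` being contractible, `K × I ≃ K × pt ≅ K`;
Hatcher 2002, Cor. 2.11). [cite: HatcherAT2002, §2.1 Cor. 2.11] -/
theorem nonempty_singularHomology_arcStrip_iso (n : ℕ) :
    Nonempty (singularHomology R M (circleArcStrip K) n ≅ singularHomology R M K n) := by
  obtain ⟨e⟩ := nonempty_quarterArcStripHomeomorph (K := K)
  haveI : ContractibleSpace I := (convex_Icc (0 : ℝ) 1).contractibleSpace ⟨0, by simp⟩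
  obtain ⟨hI⟩ := ContractibleSpace.hequiv_unit' (X := I)
  let h : ContinuousMap.HomotopyEquiv (K × I) (K × Unit) :=
    (ContinuousMap.HomotopyEquiv.refl K).prodCongr hI
  exact ⟨(singularHomology.mapIso R M e n).symm ≪≫
    singularHomology.mapIso R M (Homeomorph.prodComm I K) n ≪≫
    singularHomology.isoOfHomotopyEquiv R M h n ≪≫
    singularHomology.mapIso R M (Homeomorph.prodPUnit K) n⟩

omit [TopologicalSpace K] in
/-- The subspace `∂I × K` of the cylinder in the two spellings used by `PairTimesCircle.lean` and
`PairTimesInterval.lean` (`L = ∅`). [folklore] -/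
theorem prodUnitInterval_set_eq :
    (Prod.fst ⁻¹' ({0, 1} : Set I) ∪ Prod.snd ⁻¹' (∅ : Set K) : Set (I × K)) =
      Prod.fst ⁻¹' ({0, 1} : Set I) := by
  rw [Set.preimage_empty, Set.union_empty]

/-- **`Hₙ₊₁(S¹ × K, D × K; M) ≅ Hₙ(K; M)`**: excision and straightening to `(I, ∂I) × K`
(`relativeSingularHomology.nonempty_circlePairIso`, Hatcher Thm. 2.20 / Prop. 2.19) followed by the
relative suspension isomorphism `Hₙ₊₁((I, ∂I) × K) ≅ Hₙ(K)`
(`relativeSingularHomology.nonempty_prodUnitIntervalIso`). [cite: HatcherAT2002, §2.1 Thm. 2.20] -/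
theorem nonempty_relativeSingularHomology_circleArcStrip_iso (n : ℕ) :
    Nonempty (relativeSingularHomology R M (AddCircle (1 : ℝ) × K) (circleArcStrip K) (n + 1) ≅
      singularHomology R M K n) := by
  obtain ⟨e₁⟩ := relativeSingularHomology.nonempty_circlePairIso R M (K := K) (n + 1)
  obtain ⟨e₂⟩ := relativeSingularHomology.nonempty_prodUnitIntervalIso R M (∅ : Set K) n
  exact ⟨e₁.symm ≪≫ eqToIso (by rw [prodUnitInterval_set_eq]) ≪≫ e₂ ≪≫
    (relativeSingularHomology.emptyIso R M K n).symm⟩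

/-- **`H₀(S¹ × K, D × K; M) = 0`** (`H₀((I, ∂I) × K) = 0`: every point of the cylinder is joined
to `∂I × K` by a segment). [cite: HatcherAT2002, §2.1 Thm. 2.20] -/
theorem isZero_relativeSingularHomology_circleArcStrip_zero :
    IsZero (relativeSingularHomology R M (AddCircle (1 : ℝ) × K) (circleArcStrip K) 0) := by
  obtain ⟨e₁⟩ := relativeSingularHomology.nonempty_circlePairIso R M (K := K) 0
  have h := isZero_relativeSingularHomology_prodUnitInterval_zero R M (∅ : Set K)
  rw [prodUnitInterval_set_eq] at h
  exact h.of_iso e₁.symm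

end ArcStrip

/-! ### Finiteness and the rank bound over a field -/

section Field

variable (F : Type v) [Field F]
variable {K : Type u} [TopologicalSpace K]

/-- **Finiteness in positive degrees**: if `Hₙ₊₁(K; F)` and `Hₙ(K; F)` are finite dimensional, so
is `Hₙ₊₁(S¹ × K; F)` — exactness of `Hₙ₊₁(D × K) → Hₙ₊₁(S¹ × K) → Hₙ₊₁(S¹ × K, D × K)` with the
outer terms `≅ Hₙ₊₁(K)`, `≅ Hₙ(K)` (Hatcher 2002, §2.1 p. 118; §3.B Cor. 3B.7).
[cite: HatcherAT2002, §3.B Cor. 3B.7] -/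
theorem finite_singularHomology_circleProd_succ (n : ℕ)
    [Module.Finite F (singularHomology F F K (n + 1))] [Module.Finite F (singularHomology F F K n)] :
    Module.Finite F (singularHomology F F (AddCircle (1 : ℝ) × K) (n + 1)) := by
  obtain ⟨eA⟩ := nonempty_singularHomology_arcStrip_iso F F (K := K) (n + 1)
  obtain ⟨eC⟩ := nonempty_relativeSingularHomology_circleArcStrip_iso F F (K := K) n
  have hS := relativeSingularHomology.exact_map_ofAbsolute F F
    (X := AddCircle (1 : ℝ) × K) (circleArcStrip K) (n + 1)
  haveI : Module.Finite F (singularHomology F F (circleArcStrip K) (n + 1)) :=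
    Module.Finite.equiv eA.toLinearEquiv.symm
  haveI : Module.Finite F
      (relativeSingularHomology F F (AddCircle (1 : ℝ) × K) (circleArcStrip K) (n + 1)) :=
    Module.Finite.equiv eC.toLinearEquiv.symm
  exact hS.moduleCat_finite_X₂

/-- **Finiteness in degree zero**: if `H₀(K; F)` is finite dimensional, so is `H₀(S¹ × K; F)`
(`H₀(S¹ × K, D × K) = 0`). [cite: HatcherAT2002, §3.B Cor. 3B.7] -/
theorem finite_singularHomology_circleProd_zero [Module.Finite F (singularHomology F F K 0)] :
    Module.Finite F (singularHomology F F (AddCircle (1 : ℝ) × K) 0) := by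
  obtain ⟨eA⟩ := nonempty_singularHomology_arcStrip_iso F F (K := K) 0
  have hS := relativeSingularHomology.exact_map_ofAbsolute F F
    (X := AddCircle (1 : ℝ) × K) (circleArcStrip K) 0
  haveI : Module.Finite F (singularHomology F F (circleArcStrip K) 0) :=
    Module.Finite.equiv eA.toLinearEquiv.symm
  haveI : Module.Finite F
      (relativeSingularHomology F F (AddCircle (1 : ℝ) × K) (circleArcStrip K) 0) :=
    finite_of_isZero (isZero_relativeSingularHomology_circleArcStrip_zero F F (K := K))
  exact hS.moduleCat_finite_X₂

/-- **The rank bound in positive degrees**: `bₙ₊₁(S¹ × K) ≤ bₙ₊₁(K) + bₙ(K)` for field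
coefficients, from the exactness of `Hₙ₊₁(D × K) → Hₙ₊₁(S¹ × K) → Hₙ₊₁(S¹ × K, D × K)`
(rank–nullity: `dim X₂ = dim im f + dim im g ≤ dim X₁ + dim X₃`; Hatcher 2002, §3.B Cor. 3B.7
gives equality). [cite: HatcherAT2002, §3.B Cor. 3B.7] -/
theorem finrank_singularHomology_circleProd_succ_le (n : ℕ)
    [Module.Finite F (singularHomology F F K (n + 1))] [Module.Finite F (singularHomology F F K n)] :
    Module.finrank F (singularHomology F F (AddCircle (1 : ℝ) × K) (n + 1)) ≤
      Module.finrank F (singularHomology F F K (n + 1)) + Module.finrank F (singularHomology F F K n) := by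
  obtain ⟨eA⟩ := nonempty_singularHomology_arcStrip_iso F F (K := K) (n + 1)
  obtain ⟨eC⟩ := nonempty_relativeSingularHomology_circleArcStrip_iso F F (K := K) n
  have hS := relativeSingularHomology.exact_map_ofAbsolute F F
    (X := AddCircle (1 : ℝ) × K) (circleArcStrip K) (n + 1)
  haveI : Module.Finite F (singularHomology F F (circleArcStrip K) (n + 1)) :=
    Module.Finite.equiv eA.toLinearEquiv.symm
  haveI : Module.Finite F
      (relativeSingularHomology F F (AddCircle (1 : ℝ) × K) (circleArcStrip K) (n + 1)) :=
    Module.Finite.equiv eC.toLinearEquiv.symm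
  haveI : Module.Finite F (singularHomology F F (AddCircle (1 : ℝ) × K) (n + 1)) :=
    hS.moduleCat_finite_X₂
  have h := hS.finrank_X₂_eq
  have h1 := LinearMap.finrank_range_le
    (singularHomology.map F F
      (⟨Subtype.val, continuous_subtype_val⟩ : C(circleArcStrip K, AddCircle (1 : ℝ) × K)) (n + 1)).hom
  have h3 := Submodule.finrank_le (LinearMap.range
    (relativeSingularHomology.ofAbsolute F F (AddCircle (1 : ℝ) × K) (circleArcStrip K) (n + 1)).hom)
  rw [← eA.toLinearEquiv.finrank_eq, ← eC.toLinearEquiv.finrank_eq]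
  dsimp only at h
  omega

/-- **The rank bound in degree zero**: `b₀(S¹ × K) ≤ b₀(K)` for field coefficients (in fact an
equality: the path components of `S¹ × K` are those of `K`). [cite: HatcherAT2002, §3.B Cor. 3B.7] -/
theorem finrank_singularHomology_circleProd_zero_le [Module.Finite F (singularHomology F F K 0)] :
    Module.finrank F (singularHomology F F (AddCircle (1 : ℝ) × K) 0) ≤
      Module.finrank F (singularHomology F F K 0) := by
  obtain ⟨eA⟩ := nonempty_singularHomology_arcStrip_iso F F (K := K) 0
  have hS := relativeSingularHomology.exact_map_ofAbsolute F F
    (X := AddCircle (1 : ℝ) × K) (circleArcStrip K) 0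
  have hZ := isZero_relativeSingularHomology_circleArcStrip_zero F F (K := K)
  haveI : Module.Finite F (singularHomology F F (circleArcStrip K) 0) :=
    Module.Finite.equiv eA.toLinearEquiv.symm
  haveI : Module.Finite F
      (relativeSingularHomology F F (AddCircle (1 : ℝ) × K) (circleArcStrip K) 0) :=
    finite_of_isZero hZ
  haveI : Module.Finite F (singularHomology F F (AddCircle (1 : ℝ) × K) 0) :=
    hS.moduleCat_finite_X₂
  have h := hS.finrank_X₂_eq
  have h1 := LinearMap.finrank_range_le
    (singularHomology.map F F
      (⟨Subtype.val, continuous_subtype_val⟩ : C(circleArcStrip K, AddCircle (1 : ℝ) × K)) 0).hom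
  have h3 := finrank_range_of_isZero_target
    (relativeSingularHomology.ofAbsolute F F (AddCircle (1 : ℝ) × K) (circleArcStrip K) 0) hZ
  rw [← eA.toLinearEquiv.finrank_eq]
  dsimp only at h h3
  omega

/-- **Finiteness of all the homology of `S¹ × K`** when all of `H_•(K; F)` is finite dimensional.
[cite: HatcherAT2002, §3.B Cor. 3B.7] -/
theorem finite_singularHomology_circleProd (h : ∀ k, Module.Finite F (singularHomology F F K k))
    (k : ℕ) : Module.Finite F (singularHomology F F (AddCircle (1 : ℝ) × K) k) := by
  cases k with
  | zero => haveI := h 0; exact finite_singularHomology_circleProd_zero F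
  | succ n =>
    haveI := h (n + 1); haveI := h n
    exact finite_singularHomology_circleProd_succ F n

/-! ### The factors swapped: `K × S¹` -/

/-- `Hₖ(K × S¹) ≅ Hₖ(S¹ × K)` by the coordinate swap. [folklore] -/
theorem finite_singularHomology_prodCircle (h : ∀ k, Module.Finite F (singularHomology F F K k))
    (k : ℕ) : Module.Finite F (singularHomology F F (K × AddCircle (1 : ℝ)) k) := by
  haveI := finite_singularHomology_circleProd F h k
  exact Module.Finite.equiv
    (singularHomology.mapIso F F (Homeomorph.prodComm (AddCircle (1 : ℝ)) K) k).toLinearEquiv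

/-- `bₖ(K × S¹) = bₖ(S¹ × K)`. [folklore] -/
theorem finrank_singularHomology_prodCircle_eq (k : ℕ) :
    Module.finrank F (singularHomology F F (K × AddCircle (1 : ℝ)) k) =
      Module.finrank F (singularHomology F F (AddCircle (1 : ℝ) × K) k) :=
  ((singularHomology.mapIso F F (Homeomorph.prodComm (AddCircle (1 : ℝ)) K) k).toLinearEquiv.finrank_eq).symm

/-- **`bₙ₊₁(K × S¹) ≤ bₙ₊₁(K) + bₙ(K)`** for field coefficients. [cite: HatcherAT2002, §3.B Cor. 3B.7] -/
theorem finrank_singularHomology_prodCircle_succ_le (n : ℕ)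
    [Module.Finite F (singularHomology F F K (n + 1))] [Module.Finite F (singularHomology F F K n)] :
    Module.finrank F (singularHomology F F (K × AddCircle (1 : ℝ)) (n + 1)) ≤
      Module.finrank F (singularHomology F F K (n + 1)) + Module.finrank F (singularHomology F F K n) := by
  rw [finrank_singularHomology_prodCircle_eq]
  exact finrank_singularHomology_circleProd_succ_le F n

/-- **`b₀(K × S¹) ≤ b₀(K)`** for field coefficients. [cite: HatcherAT2002, §3.B Cor. 3B.7] -/
theorem finrank_singularHomology_prodCircle_zero_le [Module.Finite F (singularHomology F F K 0)] :
    Module.finrank F (singularHomology F F (K × AddCircle (1 : ℝ)) 0) ≤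
      Module.finrank F (singularHomology F F K 0) := by
  rw [finrank_singularHomology_prodCircle_eq]
  exact finrank_singularHomology_circleProd_zero_le F

end Field

end Literature.AlgebraicTopology.SingularHomology
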